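import Summits.BirchSwinnertonDyer.BirchSwinnertonDyer.Theorems.Rank2ObservatoryTangentCert
import HarnessLib

/-!
# BirchSwinnertonDyer — rank ≥ 2 observatory: rank-3 kernel certificate for `E(ℚ)_tors ⊇ ℤ/4`

HONEST FRAMING: per-curve certified theorems and census instruments; no claim on BSD in rank ≥ 2.

For the seven rank-3 census rows with `E(ℚ)_tors ≅ ℤ/4` the torsion annihilator has `2`-exponent
`u = 2` genuinely, and the independence criterion `three_le_mordellWeilRank_of_cosetWitness` asks for
`R ∉ 2E(ℚ) + E(ℚ)[4]`. With a rational point `T₄ = (x₄, y₄)` of order `4` (`2T₄ = T` by an integer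
TANGENT certificate `intTangent`, `2T = 0`) and `E(ℚ)[4] = {O, T₄, 2T₄, −T₄}` certified at ONE good
odd prime `ℓ₁` (`twoTorsionOnlyB`: `T̃` is the only `2`-torsion point; `halfTOnlyB`: the points `P̃`
with `x(2P̃) = x_T` are `±T̃₄`), `R ∉ 2E(ℚ) + E(ℚ)[4]` follows from one good prime `q` with
`R̃ ∉ 2Ẽ(𝔽_q)` and `R̃ + T̃₄ ∉ 2Ẽ(𝔽_q)` — the Boolean `tCosetFree` of `Rank2ObservatoryRank3WitnessT3`
with `T₄` in place of `T` (the certificates `intTangent`, `halfTOnlyB`: `Rank2ObservatoryTangentCert`).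
Results: `not_mem_twoCoset_two_of_fourTorsion_subset` (abstract), `fourTorsion_eq`,
`not_mem_twoCoset_two_of_tCosetFree` and the certificate `three_le_mordellWeilRank_of_kernelCertT4`.
Sorry-free.
References: Silverman AEC (2009) III.2.3, VII.3.1(b), VIII.6.7; Cremona (1997) §3.5.
-/

-- single-conjunct summit: `Summit.BirchSwinnertonDyer.BirchSwinnertonDyer.…` repeats the name by design
set_option linter.dupNamespace false

namespace Summit.BirchSwinnertonDyer.BirchSwinnertonDyer.Rank2Observatory

open WeierstrassCurve Literature.NumberTheory.EllipticCurves

section Abstract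

variable {A : Type*} [AddCommGroup A]

/-- If `A[4] ⊆ {0, T₄, 2T₄, −T₄}` and neither `x` nor `x + T₄` lies in `2A`, then `x ∉ 2A + A[4]`.
[folklore] -/
theorem not_mem_twoCoset_two_of_fourTorsion_subset {T₄ x : A}
    (h4 : ∀ τ : A, (2 : ℤ) ^ 2 • τ = 0 → τ = 0 ∨ τ = T₄ ∨ τ = T₄ + T₄ ∨ τ = -T₄)
    (hx : x ∉ twoCoset A 0) (hxT : x + T₄ ∉ twoCoset A 0) : x ∉ twoCoset A 2 := by
  rintro ⟨b, c, hc, rfl⟩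
  rcases h4 c hc with rfl | rfl | rfl | rfl
  · exact hx ⟨b, 0, by rw [smul_zero], rfl⟩
  · apply hxT
    refine ⟨b + c, 0, by rw [smul_zero], ?_⟩
    rw [add_zero, smul_add]
    abel
  · apply hx
    refine ⟨b + T₄, 0, by rw [smul_zero], ?_⟩
    rw [add_zero, smul_add]
    abel
  · apply hxT
    refine ⟨b, 0, by rw [smul_zero], ?_⟩
    rw [add_zero]
    abel

end Abstract

section Rational

variable (V : WeierstrassCurve ℤ)

open scoped Classical in
/-- **`E(ℚ)[4] = {O, T₄, 2T₄, −T₄}`** from an integral point `T₄ = (x₄, y₄)` with `2T₄ = T`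
(`intTangent`), `2T = 0`, and a good odd prime `ℓ₁` with `twoTorsionOnlyB` and `halfTOnlyB`, by
injectivity of reduction on prime-to-`ℓ₁` torsion. [cite: SilvermanAEC2009, Prop. VII.3.1(b)] -/
theorem fourTorsion_eq {xT yT x₄ y₄ : ℤ}
    (hT : yT ^ 2 + V.a₁ * xT * yT + V.a₃ * yT = xT ^ 3 + V.a₂ * xT ^ 2 + V.a₄ * xT + V.a₆)
    (hT2 : 2 * yT + V.a₁ * xT + V.a₃ = 0)
    (h₄ : y₄ ^ 2 + V.a₁ * x₄ * y₄ + V.a₃ * y₄ = x₄ ^ 3 + V.a₂ * x₄ ^ 2 + V.a₄ * x₄ + V.a₆)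
    (htan : intTangent V x₄ y₄ xT yT = true)
    (ℓ₁ : ℕ) [Fact ℓ₁.Prime] (hℓ₁ : ¬ (ℓ₁ : ℤ) ∣ V.Δ) (hodd : ℓ₁ ≠ 2)
    (hB₁ : twoTorsionOnlyB V ℓ₁ xT yT = true) (hB₂ : halfTOnlyB V ℓ₁ xT x₄ y₄ = true)
    (τ : (V.map (Int.castRingHom ℚ)).toAffine.Point) (hτ : (2 : ℤ) ^ 2 • τ = 0) :
    haveI := isElliptic_rat V (Δ_ne_zero_of_not_dvd V hℓ₁)
    τ = 0 ∨ τ = Affine.Point.some (x₄ : ℚ) (y₄ : ℚ)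
        (nonsingular_rat_of_eq V (Δ_ne_zero_of_not_dvd V hℓ₁) h₄) ∨
      τ = Affine.Point.some (x₄ : ℚ) (y₄ : ℚ) (nonsingular_rat_of_eq V (Δ_ne_zero_of_not_dvd V hℓ₁) h₄)
        + Affine.Point.some (x₄ : ℚ) (y₄ : ℚ)
          (nonsingular_rat_of_eq V (Δ_ne_zero_of_not_dvd V hℓ₁) h₄) ∨
      τ = -Affine.Point.some (x₄ : ℚ) (y₄ : ℚ)
        (nonsingular_rat_of_eq V (Δ_ne_zero_of_not_dvd V hℓ₁) h₄) := by
  have hΔ : V.Δ ≠ 0 := Δ_ne_zero_of_not_dvd V hℓ₁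
  haveI := isElliptic_rat V hΔ
  have hp : ℓ₁.Prime := Fact.out
  have hn : ¬ ℓ₁ ∣ 4 := fun hd =>
    hodd ((Nat.prime_dvd_prime_iff_eq hp Nat.prime_two).mp
      (hp.dvd_of_dvd_pow (by simpa using hd : ℓ₁ ∣ 2 ^ 2)))
  have eT : V.toAffine.Equation xT yT := (Affine.equation_iff xT yT).mpr hT
  have e₄ : V.toAffine.Equation x₄ y₄ := (Affine.equation_iff x₄ y₄).mpr h₄
  have hτ4 : 4 • τ = 0 := by
    have h : ((2 : ℤ) ^ 2) = ((4 : ℕ) : ℤ) := by norm_num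
    rw [h, natCast_zsmul] at hτ; exact hτ
  set T₄ : (V.map (Int.castRingHom ℚ)).toAffine.Point :=
    .some (x₄ : ℚ) (y₄ : ℚ) (nonsingular_rat_of_eq V hΔ h₄) with hT₄def
  set T : (V.map (Int.castRingHom ℚ)).toAffine.Point :=
    .some (xT : ℚ) (yT : ℚ) (nonsingular_rat_of_eq V hΔ hT) with hTdef
  have h2T₄ : T₄ + T₄ = T := some_add_self_of_intTangent V hΔ h₄ hT htan
  have h2T : 2 • T = 0 := two_nsmul_some_eq_zero V hΔ hT hT2
  have h4T₄ : 4 • T₄ = 0 := by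
    rw [show (4 : ℕ) = 2 * 2 from rfl, mul_nsmul, two_nsmul T₄, h2T₄, h2T]
  have h4T : 4 • T = 0 := by
    rw [show (4 : ℕ) = 2 * 2 from rfl, mul_nsmul, h2T, nsmul_zero]
  have hT₄red : reduceMod V ℓ₁ hℓ₁ T₄ = Affine.Point.some (x₄ : ZMod ℓ₁) (y₄ : ZMod ℓ₁)
      (nonsingular_zmod_of_equation V ℓ₁ hℓ₁ e₄) := by
    rw [hT₄def, reduceMod_some V ℓ₁ hℓ₁ e₄]
  have hred : 4 • reduceMod V ℓ₁ hℓ₁ τ = 0 := by rw [← map_nsmul, hτ4, map_zero]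
  rcases eq_of_halfTOnlyB V ℓ₁ hB₁ hB₂ (nonsingular_zmod_of_equation V ℓ₁ hℓ₁ e₄) _ hred with
    h0 | ⟨hns, hsome⟩ | hsome | hsome
  · exact Or.inl (eq_zero_of_reduceMod_eq_zero V ℓ₁ hℓ₁ τ hn hτ4 h0)
  · right; right; left
    have hTred : reduceMod V ℓ₁ hℓ₁ T = Affine.Point.some (xT : ZMod ℓ₁) (yT : ZMod ℓ₁) hns := by
      rw [hTdef, reduceMod_some V ℓ₁ hℓ₁ eT]
    have hdiff0 : reduceMod V ℓ₁ hℓ₁ (τ - T) = 0 := by rw [map_sub, hsome, hTred, sub_self]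
    have hdiff4 : 4 • (τ - T) = 0 := by rw [nsmul_sub, hτ4, h4T, sub_zero]
    rw [h2T₄]
    exact sub_eq_zero.mp (eq_zero_of_reduceMod_eq_zero V ℓ₁ hℓ₁ (τ - T) hn hdiff4 hdiff0)
  · right; left
    have hdiff0 : reduceMod V ℓ₁ hℓ₁ (τ - T₄) = 0 := by rw [map_sub, hsome, hT₄red, sub_self]
    have hdiff4 : 4 • (τ - T₄) = 0 := by rw [nsmul_sub, hτ4, h4T₄, sub_zero]
    exact sub_eq_zero.mp (eq_zero_of_reduceMod_eq_zero V ℓ₁ hℓ₁ (τ - T₄) hn hdiff4 hdiff0)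
  · right; right; right
    have hsum0 : reduceMod V ℓ₁ hℓ₁ (τ + T₄) = 0 := by rw [map_add, hsome, hT₄red, neg_add_cancel]
    have hsum4 : 4 • (τ + T₄) = 0 := by rw [nsmul_add, hτ4, h4T₄, add_zero]
    exact eq_neg_of_add_eq_zero_left
      (eq_zero_of_reduceMod_eq_zero V ℓ₁ hℓ₁ (τ + T₄) hn hsum4 hsum0)

open scoped Classical in
/-- Soundness of `tCosetFree` at `2`-exponent `u = 2`: with `E(ℚ)[4] ⊆ {O, T₄, 2T₄, −T₄}`, a rational
point `R` whose reduction passes `tCosetFree` (w.r.t. `T̃₄`) at a good prime `q` is not in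
`2E(ℚ) + E(ℚ)[4]`. [cite: SilvermanAEC2009, Prop. VII.3.1(b)] -/
theorem not_mem_twoCoset_two_of_tCosetFree (q : ℕ) [Fact q.Prime] (hq : ¬ (q : ℤ) ∣ V.Δ)
    {T₄ R : (V.map (Int.castRingHom ℚ)).toAffine.Point}
    (h4 : ∀ τ : (V.map (Int.castRingHom ℚ)).toAffine.Point,
      (2 : ℤ) ^ 2 • τ = 0 → τ = 0 ∨ τ = T₄ ∨ τ = T₄ + T₄ ∨ τ = -T₄)
    {x₄ y₄ α β α' β' : ZMod q}
    {hns₄ : (V.map (Int.castRingHom (ZMod q))).toAffine.Nonsingular x₄ y₄}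
    {hns : (V.map (Int.castRingHom (ZMod q))).toAffine.Nonsingular α β}
    (hT₄red : reduceMod V q hq T₄ = .some x₄ y₄ hns₄) (hR : reduceMod V q hq R = .some α β hns)
    (hfree : tCosetFree V q x₄ y₄ α β α' β' = true) :
    R ∉ twoCoset (V.map (Int.castRingHom ℚ)).toAffine.Point 2 := by
  simp only [tCosetFree, Bool.and_eq_true] at hfree
  obtain ⟨hc, hα, hα'⟩ := hfree
  apply not_mem_twoCoset_two_of_fourTorsion_subset h4
  · apply not_mem_twoCoset_of_map_not_mem (reduceMod V q hq)
    rw [hR]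
    exact not_mem_twoCoset_of_xDoubleFree V q hα hns
  · apply not_mem_twoCoset_of_map_not_mem (reduceMod V q hq)
    obtain ⟨h₃, e⟩ := exists_some_add_some_of_zmodChord V q hns hns₄ hc
    rw [map_add, hR, hT₄red, e]
    exact not_mem_twoCoset_of_xDoubleFree V q hα' h₃

end Rational

/-! ### The certificate variant -/

section Assembly

variable (V : WeierstrassCurve ℤ)

/-- **Rank-3 kernel certificate for `E(ℚ)_tors ⊇ ℤ/4`**: integral points `Pᵢ = (Xᵢ, Yᵢ)`; torsion
annihilator `t = 4m`, `m` odd, from two kernel point counts; integral `T = (x_T, y_T)` with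
`2y_T + a₁x_T + a₃ = 0` and `T₄ = (x₄, y₄)` with `2T₄ = T` (`intTangent`); a good odd prime `ℓ₁`
with `twoTorsionOnlyB` and `halfTOnlyB` (`E(ℚ)[4] = {O, ±T₄, T}`); for each of the seven
combinations `R` a good prime `q` with `tCosetFree` w.r.t. `T̃₄` (`R̃, R̃ + T̃₄ ∉ 2Ẽ(𝔽_q)`), the
needed sums supplied by chord certificates. Then `3 ≤ rank_ℤ E(ℚ)`.
[cite: CremonaAlgorithms1997, §3.5] [cite: SilvermanAEC2009, Thm. VIII.6.7] -/
theorem three_le_mordellWeilRank_of_kernelCertT4 {X₁ Y₁ X₂ Y₂ X₃ Y₃ : ℤ}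
    (h₁ : Y₁ ^ 2 + V.a₁ * X₁ * Y₁ + V.a₃ * Y₁ = X₁ ^ 3 + V.a₂ * X₁ ^ 2 + V.a₄ * X₁ + V.a₆)
    (h₂ : Y₂ ^ 2 + V.a₁ * X₂ * Y₂ + V.a₃ * Y₂ = X₂ ^ 3 + V.a₂ * X₂ ^ 2 + V.a₄ * X₂ + V.a₆)
    (h₃ : Y₃ ^ 2 + V.a₁ * X₃ * Y₃ + V.a₃ * Y₃ = X₃ ^ 3 + V.a₂ * X₃ ^ 2 + V.a₄ * X₃ + V.a₆)
    {S : List (ℕ × ℕ)} {t m : ℕ} (hm : m % 2 = 1) (htm : t = 2 ^ 2 * m)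
    (hS : ∀ ℓN ∈ S, ℓN.1.Prime ∧
      ∀ (x : (V.map (Int.castRingHom ℚ)).toAffine.Point) (n : ℕ), ¬ ℓN.1 ∣ n → n • x = 0 →
        ℓN.2 • x = 0)
    (ht : annihilatorCheck S t = true)
    {xT yT x₄ y₄ : ℤ}
    (hT : yT ^ 2 + V.a₁ * xT * yT + V.a₃ * yT = xT ^ 3 + V.a₂ * xT ^ 2 + V.a₄ * xT + V.a₆)
    (hT2 : 2 * yT + V.a₁ * xT + V.a₃ = 0)
    (h₄ : y₄ ^ 2 + V.a₁ * x₄ * y₄ + V.a₃ * y₄ = x₄ ^ 3 + V.a₂ * x₄ ^ 2 + V.a₄ * x₄ + V.a₆)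
    (htan : intTangent V x₄ y₄ xT yT = true)
    (ℓ₁ : ℕ) [Fact ℓ₁.Prime] (hℓ₁ : ¬ (ℓ₁ : ℤ) ∣ V.Δ) (hodd : ℓ₁ ≠ 2)
    (hB₁ : twoTorsionOnlyB V ℓ₁ xT yT = true) (hB₂ : halfTOnlyB V ℓ₁ xT x₄ y₄ = true)
    (q₁ q₂ q₃ q₁₂ q₁₃ q₂₃ q₁₂₃ : ℕ) [Fact q₁.Prime] [Fact q₂.Prime] [Fact q₃.Prime]
    [Fact q₁₂.Prime] [Fact q₁₃.Prime] [Fact q₂₃.Prime] [Fact q₁₂₃.Prime]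
    (hq₁ : ¬ (q₁ : ℤ) ∣ V.Δ) (hq₂ : ¬ (q₂ : ℤ) ∣ V.Δ) (hq₃ : ¬ (q₃ : ℤ) ∣ V.Δ)
    (hq₁₂ : ¬ (q₁₂ : ℤ) ∣ V.Δ) (hq₁₃ : ¬ (q₁₃ : ℤ) ∣ V.Δ) (hq₂₃ : ¬ (q₂₃ : ℤ) ∣ V.Δ)
    (hq₁₂₃ : ¬ (q₁₂₃ : ℤ) ∣ V.Δ)
    {A₁ B₁ : ℤ}
    (hw₁ : tCosetFree V q₁ (x₄ : ZMod q₁) (y₄ : ZMod q₁) (X₁ : ZMod q₁) (Y₁ : ZMod q₁)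
      (A₁ : ZMod q₁) (B₁ : ZMod q₁) = true)
    {A₂ B₂ : ℤ}
    (hw₂ : tCosetFree V q₂ (x₄ : ZMod q₂) (y₄ : ZMod q₂) (X₂ : ZMod q₂) (Y₂ : ZMod q₂)
      (A₂ : ZMod q₂) (B₂ : ZMod q₂) = true)
    {A₃ B₃ : ℤ}
    (hw₃ : tCosetFree V q₃ (x₄ : ZMod q₃) (y₄ : ZMod q₃) (X₃ : ZMod q₃) (Y₃ : ZMod q₃)
      (A₃ : ZMod q₃) (B₃ : ZMod q₃) = true)
    {X₁₂ Y₁₂ A₁₂ B₁₂ : ℤ}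
    (hc₁₂ : zmodChord V q₁₂ (X₁ : ZMod q₁₂) (Y₁ : ZMod q₁₂) (X₂ : ZMod q₁₂) (Y₂ : ZMod q₁₂)
      (X₁₂ : ZMod q₁₂) (Y₁₂ : ZMod q₁₂) = true)
    (hw₁₂ : tCosetFree V q₁₂ (x₄ : ZMod q₁₂) (y₄ : ZMod q₁₂) (X₁₂ : ZMod q₁₂) (Y₁₂ : ZMod q₁₂)
      (A₁₂ : ZMod q₁₂) (B₁₂ : ZMod q₁₂) = true)
    {X₁₃ Y₁₃ A₁₃ B₁₃ : ℤ}
    (hc₁₃ : zmodChord V q₁₃ (X₁ : ZMod q₁₃) (Y₁ : ZMod q₁₃) (X₃ : ZMod q₁₃) (Y₃ : ZMod q₁₃)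
      (X₁₃ : ZMod q₁₃) (Y₁₃ : ZMod q₁₃) = true)
    (hw₁₃ : tCosetFree V q₁₃ (x₄ : ZMod q₁₃) (y₄ : ZMod q₁₃) (X₁₃ : ZMod q₁₃) (Y₁₃ : ZMod q₁₃)
      (A₁₃ : ZMod q₁₃) (B₁₃ : ZMod q₁₃) = true)
    {X₂₃ Y₂₃ A₂₃ B₂₃ : ℤ}
    (hc₂₃ : zmodChord V q₂₃ (X₂ : ZMod q₂₃) (Y₂ : ZMod q₂₃) (X₃ : ZMod q₂₃) (Y₃ : ZMod q₂₃)
      (X₂₃ : ZMod q₂₃) (Y₂₃ : ZMod q₂₃) = true)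
    (hw₂₃ : tCosetFree V q₂₃ (x₄ : ZMod q₂₃) (y₄ : ZMod q₂₃) (X₂₃ : ZMod q₂₃) (Y₂₃ : ZMod q₂₃)
      (A₂₃ : ZMod q₂₃) (B₂₃ : ZMod q₂₃) = true)
    {X₀ Y₀ X₁₂₃ Y₁₂₃ A₁₂₃ B₁₂₃ : ℤ}
    (hc₀ : zmodChord V q₁₂₃ (X₁ : ZMod q₁₂₃) (Y₁ : ZMod q₁₂₃) (X₂ : ZMod q₁₂₃) (Y₂ : ZMod q₁₂₃)
      (X₀ : ZMod q₁₂₃) (Y₀ : ZMod q₁₂₃) = true)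
    (hc₁₂₃ : zmodChord V q₁₂₃ (X₀ : ZMod q₁₂₃) (Y₀ : ZMod q₁₂₃) (X₃ : ZMod q₁₂₃) (Y₃ : ZMod q₁₂₃)
      (X₁₂₃ : ZMod q₁₂₃) (Y₁₂₃ : ZMod q₁₂₃) = true)
    (hw₁₂₃ : tCosetFree V q₁₂₃ (x₄ : ZMod q₁₂₃) (y₄ : ZMod q₁₂₃) (X₁₂₃ : ZMod q₁₂₃)
      (Y₁₂₃ : ZMod q₁₂₃) (A₁₂₃ : ZMod q₁₂₃) (B₁₂₃ : ZMod q₁₂₃) = true) :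
    3 ≤ (V.map (Int.castRingHom ℚ)).mordellWeilRank := by
  classical
  have hΔ : V.Δ ≠ 0 := Δ_ne_zero_of_not_dvd V hq₁
  haveI := isElliptic_rat V hΔ
  have hm' : Odd (m : ℤ) := by exact_mod_cast Nat.odd_iff.mpr hm
  have htm' : (t : ℤ) = 2 ^ 2 * (m : ℤ) := by rw [htm]; push_cast; ring
  have htors : ∀ x : (V.map (Int.castRingHom ℚ)).toAffine.Point, IsOfFinAddOrder x →
      ((2 : ℤ) ^ 2 * (m : ℤ)) • x = 0 :=
    fun x hx => zsmul_eq_zero_of_annihilatorCheck hS ht htm' x hx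
  have h4 := fourTorsion_eq V hT hT2 h₄ htan ℓ₁ hℓ₁ hodd hB₁ hB₂
  have e₄ : V.toAffine.Equation x₄ y₄ := (Affine.equation_iff x₄ y₄).mpr h₄
  have e₁ : V.toAffine.Equation X₁ Y₁ := (Affine.equation_iff X₁ Y₁).mpr h₁
  have e₂ : V.toAffine.Equation X₂ Y₂ := (Affine.equation_iff X₂ Y₂).mpr h₂
  have e₃ : V.toAffine.Equation X₃ Y₃ := (Affine.equation_iff X₃ Y₃).mpr h₃
  refine three_le_mordellWeilRank_of_cosetWitness (V.map (Int.castRingHom ℚ)) hm' htors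
    (P₁ := .some _ _ (nonsingular_rat_of_eq V hΔ h₁))
    (P₂ := .some _ _ (nonsingular_rat_of_eq V hΔ h₂))
    (P₃ := .some _ _ (nonsingular_rat_of_eq V hΔ h₃)) ?_ ?_ ?_ ?_ ?_ ?_ ?_
  · exact not_mem_twoCoset_two_of_tCosetFree V q₁ hq₁ h4 (reduceMod_some V q₁ hq₁ e₄ _)
      (reduceMod_some V q₁ hq₁ e₁ _) hw₁
  · exact not_mem_twoCoset_two_of_tCosetFree V q₂ hq₂ h4 (reduceMod_some V q₂ hq₂ e₄ _)
      (reduceMod_some V q₂ hq₂ e₂ _) hw₂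
  · exact not_mem_twoCoset_two_of_tCosetFree V q₃ hq₃ h4 (reduceMod_some V q₃ hq₃ e₄ _)
      (reduceMod_some V q₃ hq₃ e₃ _) hw₃
  · obtain ⟨h', e⟩ := exists_some_add_some_of_zmodChord V q₁₂
      (nonsingular_zmod_of_equation V q₁₂ hq₁₂ e₁) (nonsingular_zmod_of_equation V q₁₂ hq₁₂ e₂) hc₁₂
    refine not_mem_twoCoset_two_of_tCosetFree V q₁₂ hq₁₂ h4 (hns := h')
      (reduceMod_some V q₁₂ hq₁₂ e₄ _) ?_ hw₁₂
    rw [map_add, reduceMod_some V q₁₂ hq₁₂ e₁, reduceMod_some V q₁₂ hq₁₂ e₂, e]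
  · obtain ⟨h', e⟩ := exists_some_add_some_of_zmodChord V q₁₃
      (nonsingular_zmod_of_equation V q₁₃ hq₁₃ e₁) (nonsingular_zmod_of_equation V q₁₃ hq₁₃ e₃) hc₁₃
    refine not_mem_twoCoset_two_of_tCosetFree V q₁₃ hq₁₃ h4 (hns := h')
      (reduceMod_some V q₁₃ hq₁₃ e₄ _) ?_ hw₁₃
    rw [map_add, reduceMod_some V q₁₃ hq₁₃ e₁, reduceMod_some V q₁₃ hq₁₃ e₃, e]
  · obtain ⟨h', e⟩ := exists_some_add_some_of_zmodChord V q₂₃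
      (nonsingular_zmod_of_equation V q₂₃ hq₂₃ e₂) (nonsingular_zmod_of_equation V q₂₃ hq₂₃ e₃) hc₂₃
    refine not_mem_twoCoset_two_of_tCosetFree V q₂₃ hq₂₃ h4 (hns := h')
      (reduceMod_some V q₂₃ hq₂₃ e₄ _) ?_ hw₂₃
    rw [map_add, reduceMod_some V q₂₃ hq₂₃ e₂, reduceMod_some V q₂₃ hq₂₃ e₃, e]
  · obtain ⟨h', e⟩ := exists_some_add_some_of_zmodChord V q₁₂₃
      (nonsingular_zmod_of_equation V q₁₂₃ hq₁₂₃ e₁) (nonsingular_zmod_of_equation V q₁₂₃ hq₁₂₃ e₂)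
      hc₀
    obtain ⟨h'', e'⟩ := exists_some_add_some_of_zmodChord V q₁₂₃ h'
      (nonsingular_zmod_of_equation V q₁₂₃ hq₁₂₃ e₃) hc₁₂₃
    refine not_mem_twoCoset_two_of_tCosetFree V q₁₂₃ hq₁₂₃ h4 (hns := h'')
      (reduceMod_some V q₁₂₃ hq₁₂₃ e₄ _) ?_ hw₁₂₃
    rw [map_add, map_add, reduceMod_some V q₁₂₃ hq₁₂₃ e₁, reduceMod_some V q₁₂₃ hq₁₂₃ e₂,
      reduceMod_some V q₁₂₃ hq₁₂₃ e₃, e, e']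

end Assembly

end Summit.BirchSwinnertonDyer.BirchSwinnertonDyer.Rank2Observatory
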